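import Summits.ResolutionOfSingularities.ResolutionOfSingularities.Theses.MaxContactCut
import Summits.ResolutionOfSingularities.ResolutionOfSingularities.Theorems.TightDefectStrongWalks
import Summits.ResolutionOfSingularities.ResolutionOfSingularities.Theorems.MaxContactCutForcedTowers
import HarnessLib

/-!
# MaxContactCutTightDefect — the decomp-res node «TightDefect» (lens-3 g9, CRITIC-LEDGER row 61 CLEARED) wired BY NAME
  to the MaxContactCut items

Host route `MaxContactCut` (route-ResolutionOfSingularities-MaxContactCut); asides of this node:
`PolyPureTowersShallow`
[KNOWN-MOD-PORT: Cossart–Piltant 2019 Thm. 1.5 (i) through `ShallowColumnPort`, prover target #20],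
`PolyPureTowersDeep` [UNDECIDED · THE located E-side residual, `e ≥ 2`], `DefectWalksDeep` [UNDECIDED · model
residual,
INSTRUMENTABLE T-tight-1 at `q = p²`], `PolyPureReduction` [rung · UNDECIDED]; parents 30253 `NoForcedTowers`, 30256
`NoStationarySatelliteTowers`, 29273 `RungOne`.  Vocabulary: `Theorems.TightDefectClasses` (slice, columns,
forced-walk
model, pieces, ports) and `Theorems.TightDefectStrongWalks` (`strongWalksTerminate`, PROVED).

Kernels (all PROVED, 0 sorry): slice ⟸ 30253 by instantiation (`polyPureTowersTerminate_of_noForcedTowers`), ⟸ `E 1`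
mod the counting port `TowerObstructs`, ⟸ `E 2 ∧ RungOne`, ⟸ the g7 leaves 30255–30257; rung `PolyPureReduction`
⟸ `E 1`
(an instance of `SeqDimFour 1 (pᵉ)`); asides ⟺ classes defs (`Iff.rfl`); 30253 ⟹ both columns; EXACT slice ⟺ columns;
the COLLAPSE assembly `PolyPureTowersShallow → TowerDictionary → DefectWalksDeep → slice` and its CP-discharged form;
NECESSITY ledger 30253 ⟹ every model piece (mod `TowerRealisation`).  The root is reached by the route's own `closes`
(the node is an aside ladder; cone unchanged) — not restated here.

References: CossartPiltant2019 Thm. 1.5 (i); Hauser2010 §§F–G; Moh1987; Benito–Villamayor 2013 §7;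
BierstoneGrigorievMilmanWlodarczyk2011 §3.
-/

open CategoryTheory AlgebraicGeometry
open Literature.AlgebraicGeometry.Resolution
open Summit.ResolutionOfSingularities.ResolutionOfSingularities.Theses
open Summit.ResolutionOfSingularities.ResolutionOfSingularities.Theorems.WeakOrderReduction
open Summit.ResolutionOfSingularities.ResolutionOfSingularities.Theorems.ForcedTowerClasses
open Summit.ResolutionOfSingularities.ResolutionOfSingularities.Theorems.TightDefectClasses
open Summit.ResolutionOfSingularities.ResolutionOfSingularities.Theorems.TightDefectStrongWalks

namespace Summit.ResolutionOfSingularities.ResolutionOfSingularities.Theorems.MaxContactCutTightDefect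

/-! ## The asides are the classes defs (definitional) -/

/-- Aside `PolyPureTowersShallow` ⟺ the `e = 1` column. [folklore] -/
theorem polyPureTowersShallow_iff : MaxContactCut.PolyPureTowersShallow ↔ PolyPureTowersTerminateShallow := Iff.rfl

/-- Aside `PolyPureTowersDeep` ⟺ the `e ≥ 2` column. [folklore] -/
theorem polyPureTowersDeep_iff : MaxContactCut.PolyPureTowersDeep ↔ PolyPureTowersTerminateDeep := Iff.rfl

/-- Aside `DefectWalksDeep` ⟺ the deep tight-defect residual of the model. [folklore] -/
theorem defectWalksDeep_iff : MaxContactCut.DefectWalksDeep ↔ DefectWalksTerminateDeep := Iff.rfl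

/-- Aside `PolyPureReduction` ⟺ the classes rung. [folklore] -/
theorem polyPureReduction_iff :
    MaxContactCut.PolyPureReduction ↔ TightDefectClasses.PolyPureReduction := Iff.rfl

/-! ## E-side necessity: the slice and the rung hang under 30253 / `E 1` / 29273 BY NAME -/

/-- **Slice ⟸ 30253 `NoForcedTowers`** by instantiation (marking `n = pᵉ ≥ 1`). [folklore] -/
theorem polyPureTowersTerminate_of_noForcedTowers (h : MaxContactCut.NoForcedTowers) : PolyPureTowersTerminate := by
  intro p hp e _ k _ _ _ F T g hB hD hE _
  exact h (p ^ e) (Nat.one_le_pow e p hp.pos) p hp k T g hB hD hE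

/-- **Slice ⟸ `E 1`** modulo the tree's counting port `TowerObstructs`. [folklore] -/
theorem polyPureTowersTerminate_of_e_one (hT : ∀ n, 1 ≤ n → TowerObstructs n) (h : E 1) :
    PolyPureTowersTerminate :=
  polyPureTowersTerminate_of_noForcedTowers (MaxContactCutForcedTowers.noForcedTowers_of_e_one hT h)

/-- **Slice ⟸ `E 2 ∧ RungOne` (29273) BY NAME** modulo `TowerObstructs`. [folklore] -/
theorem polyPureTowersTerminate_of_rungOne (hT : ∀ n, 1 ≤ n → TowerObstructs n) (h2 : E 2)
    (r1 : MaxContactCut.RungOne) : PolyPureTowersTerminate :=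
  polyPureTowersTerminate_of_e_one hT (r1 h2)

/-- **Slice ⟸ 30255 ∧ 30256 ∧ 30257** through the tree's leaf calculus. [folklore] -/
theorem polyPureTowersTerminate_of_leaves (h₁ : MaxContactCut.NoStationaryFreeTowers)
    (h₂ : MaxContactCut.NoStationarySatelliteTowers) (h₃ : MaxContactCut.NoGrowingTowers) :
    PolyPureTowersTerminate :=
  polyPureTowersTerminate_of_noForcedTowers (MaxContactCutForcedTowers.noForcedTowers_of_leaves h₁ h₂ h₃)

/-- **30253 ⟹ both column asides** (NECESSITY ledger). [folklore] -/
theorem columns_of_noForcedTowers (h : MaxContactCut.NoForcedTowers) :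
    MaxContactCut.PolyPureTowersShallow ∧ MaxContactCut.PolyPureTowersDeep :=
  polyPureTowersTerminate_iff_columns.mp (polyPureTowersTerminate_of_noForcedTowers h)

/-- **EXACT: slice ⟺ the two column asides.** [folklore] -/
theorem polyPureTowersTerminate_iff_asides :
    PolyPureTowersTerminate ↔ MaxContactCut.PolyPureTowersShallow ∧ MaxContactCut.PolyPureTowersDeep :=
  polyPureTowersTerminate_iff_columns

/-- **Rung aside ⟸ `E 1`**: `PolyPureReduction` is an instance of the tree schema `SeqDimFour 1 (pᵉ)` (class ≥ 1 is no
condition; the perfectness of `k` is not used). [folklore] -/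
theorem polyPureReduction_of_e_one (h : E 1) : MaxContactCut.PolyPureReduction := by
  intro p hp e _ k _ _ _ F s _ hfr
  obtain ⟨g, hg1, hg2, hg3, hY, hY4, hord⟩ := hfr
  exact h (p ^ e) (Nat.one_le_pow e p hp.pos) p hp k s.top g hg1 hg2 hg3 hY hY4 (reachMarked k (p ^ e) F s).ideal hord
    (fun y _ => Or.inl le_rfl)

/-- **Rung aside ⟸ `E 2 ∧ RungOne` (29273) BY NAME.** [folklore] -/
theorem polyPureReduction_of_rungOne (h2 : E 2) (r1 : MaxContactCut.RungOne) : MaxContactCut.PolyPureReduction :=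
  polyPureReduction_of_e_one (r1 h2)

/-- **NECESSITY LEDGER** (modulo the realisation port): 30253 ⟹ slice ⟹ every model piece. [folklore] -/
theorem pieces_of_noForcedTowers (hR : TowerRealisation) (h : MaxContactCut.NoForcedTowers) :
    PolyPureTowersTerminate ∧ WalksTerminate ∧ StrongWalksTerminate ∧ DefectWalksTerminate ∧
      SatDefectWalksTerminate ∧ MaxContactCut.DefectWalksDeep :=
  have hP := polyPureTowersTerminate_of_noForcedTowers h
  have hW := pieces_of_polyPureTowers hR hP
  ⟨hP, hW.1, hW.2.1, hW.2.2.1, hW.2.2.2, defectDeep_of_defect hW.2.2.1⟩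

/-! ## The collapse assembly (critic row 61): CP column ∧ dictionary ∧ deep tight-defect residual ⟹ slice -/

/-- The E-format slice hangs on the whole-`e` residual alone (modulo the dictionary port), by the PROVED
`strongWalksTerminate`. [folklore] -/
theorem polyPureTowersTerminate_of_defect (hT : TowerDictionary) (hD : DefectWalksTerminate) :
    PolyPureTowersTerminate :=
  polyPureTowersTerminate_of_pieces hT strongWalksTerminate hD

/-- **Deep column aside ⟸ dictionary ∧ deep residual aside.** [folklore] -/
theorem polyPureTowersDeep_of_defectWalksDeep (hT : TowerDictionary) (hΔ : MaxContactCut.DefectWalksDeep) :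
    MaxContactCut.PolyPureTowersDeep :=
  polyPureTowersTerminateDeep_of_defectDeep hT hΔ

/-- **ASSEMBLY after the collapse: slice ⟸ shallow aside ∧ dictionary ∧ deep residual aside.** [folklore] -/
theorem polyPureTowersTerminate_of_collapse (h₁ : MaxContactCut.PolyPureTowersShallow) (hT : TowerDictionary)
    (hΔ : MaxContactCut.DefectWalksDeep) : PolyPureTowersTerminate :=
  polyPureTowersTerminate_of_columns h₁ (polyPureTowersTerminateDeep_of_defectDeep hT hΔ)

/-- **The shallow aside is DECIDED modulo the valuative port**: Cossart–Piltant 2019 Thm. 1.5 (i) (NORMALLY-FLAT tree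
fact, BY NAME) through `ShallowColumnPort` (prover target #20). [folklore] -/
theorem polyPureTowersShallow_of_cp
    (hCP : Literature.AlgebraicGeometry.Resolution.CossartPiltant2019LocalPermissible.{0}) (hV : ShallowColumnPort) :
    MaxContactCut.PolyPureTowersShallow :=
  shallow_of_port hCP hV

/-- … so the slice hangs on the dictionary and the deep residual aside, modulo the CP fact and the port. [folklore] -/
theorem polyPureTowersTerminate_of_cp
    (hCP : Literature.AlgebraicGeometry.Resolution.CossartPiltant2019LocalPermissible.{0}) (hV : ShallowColumnPort)
    (hT : TowerDictionary) (hΔ : MaxContactCut.DefectWalksDeep) : PolyPureTowersTerminate :=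
  polyPureTowersTerminate_of_collapse (polyPureTowersShallow_of_cp hCP hV) hT hΔ

/-- **EXACT modulo the two translation ports: deep column aside ⟺ deep residual aside** (the converse direction
through `TowerRealisation` restricted to `e ≥ 2` needs the whole slice; recorded one-sided plus the whole-`e` iff).
[folklore] -/
theorem walksTerminate_iff_asides (hD : TowerDictionary) (hR : TowerRealisation) :
    WalksTerminate ↔ MaxContactCut.PolyPureTowersShallow ∧ MaxContactCut.PolyPureTowersDeep :=
  (polyPureTowersTerminate_iff_walksTerminate hD hR).symm.trans polyPureTowersTerminate_iff_columns

end Summit.ResolutionOfSingularities.ResolutionOfSingularities.Theorems.MaxContactCutTightDefect
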